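import Literature.AlgebraicGeometry.HodgeTheory.BettiUniverseHodgeRiemann
import HarnessLib

/-!
# Hodge–Riemann for `H^{2,0}` of a surface WITH SIGN: `∫_X η ∧ η̄ = κ_X · t`, `t > 0`

Family `hodge`, layer `Literature/AlgebraicGeometry/HodgeTheory`. Theorems only (no named fact, no
definition). The tree's `BettiUniverse.HodgeRiemann20_holds` (`BettiUniverseHodgeRiemann`) records
Voisin I Thm. 6.32 at `k = 2`, `(p,q) = (2,0)` only as a NON-VANISHING statement
`trC hX 4 (η ∪ conj η) ≠ 0` (the tree fixes no orientation `H⁴(X(ℂ); ℂ) ≅ ℂ`). This file keeps the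
SIGN, orientation-free: for `X` smooth projective of dimension `2` there is ONE non-zero constant
`κ_X ∈ ℂ` (the light trace of the rational top vector times the top coordinate of the Kähler top
class of a fixed Kähler datum) such that for every non-zero `η ∈ F²(ℂ ⊗_ℚ H²(X(ℂ); ℚ))`

  `trC hX 4 (η ∪ conj η) = κ_X · t` with `t ∈ ℝ`, `t > 0`.

Equivalently, `η, η' ↦ κ_X⁻¹ · trC hX 4 (η ∪ conj η')` is a positive definite hermitian form on
`F² = H^{2,0}` — the printed statement ("the form `(-1)^{k(k-1)/2} i^{p-q-k} H_k` is positive definite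
on `H^{p,q}_prim`", every `(2,0)`-class on a surface being primitive). Same proof as
`HodgeRiemann20_holds`, with the Kähler datum `D` (`nonempty_kaehlerRationalDatum`) CHOSEN ONCE
before `η` so that the constant does not depend on `η`.

* `BettiUniverse.hodgeRiemann20_positive` — for every real Hodge model `A`;
* `BettiUniverse.hodgeRiemann_two_zero_positive` — for the tree's Hodge structure `hodge hHD hX 2`.

## References

* [VoisinHodgeI2002] C. Voisin, *Hodge Theory and Complex Algebraic Geometry I*, CUP 2002, §6.3.2
  Thm. 6.32 (held edition PDF p. 128), §6.1.3 Cor. 6.12.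
* [GriffithsHarris1978] P. Griffiths, J. Harris, *Principles of Algebraic Geometry*, Wiley 1978,
  Ch. 0 §7 p. 123.
-/

noncomputable section

open scoped TensorProduct
open CategoryTheory Module
open Literature.AlgebraicTopology.SingularHomology
open Literature.Geometry.Kaehler (lefschetzPow lefschetzPow_succ lefschetzPow_zero lefschetzOperator_apply)
open Literature.AlgebraicGeometry.Motives (bettiCohomology bettiCup ofRatClassBaseChange
  ofRatClassBaseChange_tmul)

namespace Literature.AlgebraicGeometry.HodgeTheory

namespace BettiUniverse

section Positive

variable {n : ℕ} {X : Motives.SchemeOver ℂ}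

/-- **Hodge–Riemann for `(2,0)`-classes on a surface, with sign.** For `X` smooth projective of
dimension `2` and a real Hodge model `A` there is a constant `κ ≠ 0` such that for every non-zero
`η ∈ F²(ℂ ⊗_ℚ H²(X(ℂ); ℚ))`, `trC hX 4 (η ∪ conj η) = κ * t` for some real `t > 0`.
Voisin I Thm. 6.32 ("the form `(-1)^{k(k-1)/2} i^{p-q-k} H_k` is positive definite on `H^{p,q}_prim`")
at `k = 2`, `(p,q) = (2,0)`: every `(2,0)`-class is primitive (`L η` has type `(3,1)`, zero on a
surface) and `(-1)¹ i⁰ H_2(η,η) = ∫_X η ∧ η̄ > 0`; the light trace `trC hX 4` is a fixed non-zero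
multiple of `∫_X`. [cite: VoisinHodgeI2002, §6.3.2 Thm. 6.32] [cite: GriffithsHarris1978, Ch. 0 §7 p. 123] -/
theorem hodgeRiemann20_positive (hX : Motives.IsSmoothProjective 2 X) (A : HodgeModel 2 X)
    (hA : A.IsReal) :
    ∃ κ : ℂ, κ ≠ 0 ∧ ∀ η : ℂ ⊗[ℚ] bettiCohomology X 2,
      η ∈ (A.hodgeStructure hX hA.isHodgeSymmetric 2).F 2 → η ≠ 0 →
        ∃ t : ℝ, 0 < t ∧
          trC hX 4 (LinearMap.BilinMap.baseChange ℂ (cup X 2 2) η (Motives.HodgeStructure.conj η)) =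
            κ * t := by
  -- fix ONE Kähler datum; the constant is read off it
  obtain ⟨D⟩ := nonempty_kaehlerRationalDatum hX
  refine ⟨(tr hX (2 * 2) (ratTopVec hX) : ℂ) * cTopCoord hX D.topClass,
    mul_ne_zero (by exact_mod_cast tr_ratTopVec_ne_zero hX) (D.cTopCoord_topClass_ne_zero hX), ?_⟩
  intro η hη h0
  set ξ : complexBetti X 2 := ofRatClassBaseChange (Motives.ComplexPoints X) 2 η with hξ_def
  -- `ξ` is of type `(2,0)` and non-zero
  have h20 : IsOfHodgeType 2 X 2 2 0 ξ :=
    isOfHodgeType_of_mem_hodgeStructure_F_self hX A hA.isHodgeSymmetric 2 hη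
  have hξ0 : ξ ≠ 0 := fun h ↦ h0 (ofRatClassBaseChange_injective _ 2 (by rw [← hξ_def, h, map_zero]))
  -- `ξ` is primitive: `L ξ = η_D ∪ ξ` has type `(3,1)`, zero on a surface
  have hprim : lefschetzPow D.Hη (0 + 1) 2 ξ = 0 := by
    rw [lefschetzPow_succ, LinearMap.comp_apply, lefschetzPow_zero, LinearMap.id_apply,
      lefschetzOperator_apply]
    exact cupProduct_eq_zero_of_types_surface hX D.isOfHodgeType_Hη h20 _
  -- Hodge–Riemann on `X(ℂ)`: `i^{2-0} (-1)^{1} (ξ ∪ ξ̄) = t • Ω`, `t > 0`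
  obtain ⟨t, ht, heq⟩ := D.hodgeRiemann_X hX (a := 2) (s := 2) (t' := 0) (r₀ := 0) rfl rfl h20 hξ0 hprim
  rw [lefschetzPow_zero, LinearMap.id_apply] at heq
  have hscal : (Complex.I ^ ((2 : ℕ) - (0 : ℕ) : ℤ) * (-1) ^ (2 * (2 - 1) / 2) : ℂ) = 1 := by
    norm_num [zpow_ofNat, Complex.I_sq]
  rw [hscal, one_smul] at heq
  refine ⟨t, ht, ?_⟩
  -- the left-hand side, read in `H⁴(X(ℂ); ℂ)`
  have hcup : ofRatClassBaseChange (Motives.ComplexPoints X) (2 + 2)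
      (LinearMap.BilinMap.baseChange ℂ (cup X 2 2) η (Motives.HodgeStructure.conj η)) =
        cupProduct rfl ξ (conjClass _ 2 ξ) := by
    rw [ofRatClassBaseChange_cup2, KaehlerRationalDatum.ofRatClassBaseChange_conj hX A]
  have e := trC_eq_smul_cTopCoord hX
    (LinearMap.BilinMap.baseChange ℂ (cup X 2 2) η (Motives.HodgeStructure.conj η))
  refine e.trans ?_
  change (tr hX (2 * 2) (ratTopVec hX) : ℂ) *
    cTopCoord hX (ofRatClassBaseChange (Motives.ComplexPoints X) (2 + 2) _) = _
  rw [hcup, heq, map_smul, smul_eq_mul]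
  ring

/-- **Hodge–Riemann in bidegree `(2,0)` on a surface, with sign, for the standard Hodge structure
`hodge hHD hX 2`**: there is `κ ≠ 0` with `trC hX 4 (η ∪ conj η) = κ * t`, `t > 0`, for every
non-zero `η ∈ F²(ℂ ⊗_ℚ H²(X(ℂ); ℚ))`, `dim X = 2` (so `η ↦ κ⁻¹ · ∫ η ∧ η̄` is positive definite on
`H^{2,0}`). [cite: VoisinHodgeI2002, §6.3.2 Thm. 6.32] -/
theorem hodgeRiemann_two_zero_positive (hHD : exists_isReal_hodgeModel)
    (hX : Motives.IsSmoothProjective n X) (hn : n = 2) :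
    ∃ κ : ℂ, κ ≠ 0 ∧ ∀ η : ℂ ⊗[ℚ] bettiCohomology X 2, η ∈ (hodge hHD hX 2).F 2 → η ≠ 0 →
      ∃ t : ℝ, 0 < t ∧
        trC hX 4 (LinearMap.BilinMap.baseChange ℂ (cup X 2 2) η (Motives.HodgeStructure.conj η)) =
          κ * t := by
  subst hn
  exact hodgeRiemann20_positive hX (realHodgeModel hHD hX) (realHodgeModel_isReal hHD hX)

end Positive

end BettiUniverse

end Literature.AlgebraicGeometry.HodgeTheory

end
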